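import Summits.HodgeConjecture.HodgeConjecture.Theorems.HeckePrymWeilWeilTwelvefoldsSqrtMinus7CmEndomorphism
import Literature.NumberTheory.EllipticCurves.ComplexMultiplicationDeuringReductionCoxEndProofs
import Literature.NumberTheory.EllipticCurves.UniformizationProofs
import HarnessLib

/-!
# The CM curve `j = -3375` with `[w]`, `w = (1+√-7)/2`, as an `AbelianVariety ℂ` endomorphism

Crux `WeilTwelvefoldsSqrtMinus7` (stmt-HodgeConjecture-1261), line `amnesic-secant-sheaves-split-fourteenfolds`,
stub T_A1 `stub_cmCurveAction` (lead seat c1), PROVED: there are a period pair `L` (the lattice with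
invariants `(g₂, g₃) = (35, −49)`, `j = −15³`, uniformisation theorem `PeriodPair.uniformization_holds`),
`w = (1 + i√7)/2` (`w² = w − 2`), the integer matrix `N` of `w` on the basis `(ω₁, ω₂)` of `Λ`
(`wΛ ⊆ Λ`, `PeriodPair.mul_mem_lattice_of_transformation`), and an endomorphism `ι` of the abelian variety
`E_Λ` with `ι ≫ ι = ι − 2` acting on complex points as `π(z) ↦ π(wz)` — from the kernel-checked transformation
certificate `CMCert.check7` (`℘(wz) = (P/Q)(℘ z)`), `exists_endomorphism_of_transformation` (Milne's extension
theorem + rigidity), and faithfulness of `ℂ`-points (`SchemeOver.hom_ext_of_forall_algPoints`).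

## References
* D. A. Cox, *Primes of the form x² + ny²*, 2nd ed. (2013), §14.B, Prop. 14.9. [Cox2013]
* J. H. Silverman, *Advanced Topics in the Arithmetic of Elliptic Curves* (1994), Prop. II.2.3.1 (iii).
-/

noncomputable section

set_option linter.dupNamespace false

open CategoryTheory AlgebraicGeometry Polynomial MonoidalCategory CartesianMonoidalCategory
open scoped Polynomial.Bivariate
open Literature.AlgebraicGeometry Literature.AlgebraicGeometry.Motives
open Literature.NumberTheory.EllipticCurves

namespace Summit.HodgeConjecture.HodgeConjecture.Theorems.WeilTwelvefoldsSqrtMinus7.AmnesicSecantSheaves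

/-- `w = (1 + i√7)/2` satisfies `w² = w − 2` (`w` is `(1+√-7)/2`, a generator of `𝓞_{ℚ(√-7)}`). [folklore] -/
theorem cmGenSeven_sq :
    ((1 + Complex.I * (Real.sqrt 7 : ℂ)) / 2) ^ 2 = (1 : ℤ) * ((1 + Complex.I * (Real.sqrt 7 : ℂ)) / 2) - (2 : ℤ) := by
  have h7 : ((Real.sqrt 7 : ℝ) : ℂ) ^ 2 = 7 := by
    rw [← Complex.ofReal_pow, Real.sq_sqrt (by norm_num : (0 : ℝ) ≤ 7)]; norm_num
  have hI : Complex.I ^ 2 = -1 := Complex.I_sq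
  push_cast
  linear_combination (-1 / 4 : ℂ) * h7 + ((Real.sqrt 7 : ℂ) ^ 2 / 4) * hI

section
open scoped MonObj

/-- The statement of `stub_cmCurveAction` with the bound endomorphism named `φ₀` (the `MonObj` scope, needed
for the group structure on morphisms in the proof, reserves the token `ι`). [cite: Cox2013, Prop. 14.9 (PDF pp. 318–319)] -/
theorem stub_cmCurveAction_aux :
    ∃ (L : PeriodPair) (w : ℂ) (N : Matrix (Fin 2) (Fin 2) ℤ) (φ₀ : (L.curve.abelianVarietyOfAddHom L.curve.addHom L.curve.negHom L.curve.lift_pointEquiv_comp_addHom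
          L.curve.pointEquiv_comp_negHom_geom) ⟶
        (L.curve.abelianVarietyOfAddHom L.curve.addHom L.curve.negHom L.curve.lift_pointEquiv_comp_addHom
          L.curve.pointEquiv_comp_negHom_geom)),
      w * w = w - 2 ∧
      (w * L.ω₁ = (N 0 0 : ℂ) * L.ω₁ + (N 0 1 : ℂ) * L.ω₂) ∧
      (w * L.ω₂ = (N 1 0 : ℂ) * L.ω₁ + (N 1 1 : ℂ) * L.ω₂) ∧
      φ₀ ≫ φ₀ = φ₀ - (2 : ℤ) • 𝟙 (L.curve.abelianVarietyOfAddHom L.curve.addHom L.curve.negHom L.curve.lift_pointEquiv_comp_addHom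
          L.curve.pointEquiv_comp_negHom_geom) ∧
      ∀ z : ℂ, L.upoint z ≫ φ₀.hom.hom.hom = L.upoint (w * z) := by
  -- the lattice with invariants `(35, -49)` and the multiplier `w`
  obtain ⟨L, hL2, hL3⟩ := PeriodPair.uniformization_holds 35 (-49) (by norm_num)
  set E : AbelianVariety ℂ := L.curve.abelianVarietyOfAddHom L.curve.addHom L.curve.negHom
    L.curve.lift_pointEquiv_comp_addHom L.curve.pointEquiv_comp_negHom_geom with hE
  set w : ℂ := (1 + Complex.I * (Real.sqrt 7 : ℂ)) / 2 with hwdef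
  have hw2 : w ^ 2 = (1 : ℤ) * w - (2 : ℤ) := cmGenSeven_sq
  have hwim : w.im ≠ 0 := by
    rw [hwdef]
    simp only [Complex.div_ofNat_im, Complex.add_im, Complex.one_im, Complex.mul_im, Complex.I_re,
      Complex.ofReal_im, mul_zero, Complex.I_im, Complex.ofReal_re, one_mul, zero_add]
    positivity
  have hw0 : w ≠ 0 := fun h => hwim (by rw [h, Complex.zero_im])
  -- the certificate: `℘(wz) = (P/Q)(℘ z)` for `(g₂, g₃) = (35, -49)`
  have hcert := CMCert.check_sound hw2 hwim CMCert.check7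
  have hα : CMCert.ZW.toC w ⟨0, 1⟩ = w := by simp [CMCert.ZW.toC_mk]
  rw [hα, show ((35 : ℤ) : ℂ) = L.g₂ by rw [hL2]; norm_num, show ((-49 : ℤ) : ℂ) = L.g₃ by rw [hL3]; norm_num]
    at hcert
  obtain ⟨hQ, h1, h2⟩ := hcert
  have hdeg := CMCert.natDegree_toPoly_lt hwim (P := [⟨-49, 35⟩, ⟨12, 4⟩, ⟨-4, -4⟩]) (Q := [⟨-32, 8⟩, ⟨16, 0⟩])
    (by decide) (by decide) (by decide)
  -- the endomorphism
  obtain ⟨φ, hφ⟩ := exists_endomorphism_of_transformation L hw0 hQ hdeg h1 h2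
  -- the matrix of `w` on `(ω₁, ω₂)`
  have hwΛ : ∀ l ∈ L.lattice, w * l ∈ L.lattice := fun l hl =>
    L.mul_mem_lattice_of_transformation hw0 hQ h1 h2 hl
  obtain ⟨a, b, hab⟩ := PeriodPair.mem_lattice.mp (hwΛ _ L.ω₁_mem_lattice)
  obtain ⟨c, d, hcd⟩ := PeriodPair.mem_lattice.mp (hwΛ _ L.ω₂_mem_lattice)
  refine ⟨L, w, !![a, b; c, d], φ, by rw [← sq, hw2]; push_cast; ring, ?_, ?_, ?_, hφ⟩
  · simp only [Matrix.of_apply, Matrix.cons_val', Matrix.cons_val_zero, Matrix.cons_val_one,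
      Matrix.cons_val_fin_one]; exact hab.symm
  · simp only [Matrix.of_apply, Matrix.cons_val', Matrix.cons_val_zero, Matrix.cons_val_one,
      Matrix.cons_val_fin_one]; exact hcd.symm
  -- `ι ≫ ι = ι - 2` on `ℂ`-points, hence as morphisms
  have hsub : φ - (2 : ℤ) • 𝟙 E = φ - 𝟙 E - 𝟙 E := by rw [two_zsmul, sub_sub]
  rw [hsub]
  apply AbelianVariety.hom_ext
  haveI : IsReduced E.X.left := AbelianVariety.isReduced_left E
  refine SchemeOver.hom_ext_of_forall_algPoints ℂ fun p => ?_
  obtain ⟨z, rfl⟩ := L.upoint_surjective p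
  -- both sides on `ℂ`-points, in the group `E_Λ(ℂ)`
  letI instGrp : GrpObj L.curve.scheme := E.grpObj
  let φ' : L.curve.scheme ⟶ L.curve.scheme := φ.hom.hom.hom
  have hφ' : ∀ z : ℂ, L.upoint z ≫ φ' = L.upoint (w * z) := hφ
  have lhs : L.upoint z ≫ (φ ≫ φ).hom.hom.hom = L.upoint (w * (w * z)) := by
    change (L.upoint z ≫ φ') ≫ φ' = _
    rw [hφ', hφ']
  let pe : L.curve.toAffine.Point ≃ AlgPoints L.curve.scheme ℂ := L.curve.pointEquiv (L := ℂ)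
  have hupt : ∀ z : ℂ, L.upoint z = pe (L.toPoint z) := fun z => rfl
  have hmul : ∀ x y : L.curve.toAffine.Point, pe (x + y) = pe x * pe y := by
    intro x y
    change L.curve.pointEquiv (x + y) = lift (L.curve.pointEquiv x) (L.curve.pointEquiv y) ≫ L.curve.addHom
    exact (L.curve.lift_pointEquiv_comp_addHom_of_field (L := ℂ) x y).symm
  have hdiv : ∀ x y : L.curve.toAffine.Point, pe (x - y) = pe x / pe y := fun x y => by
    rw [eq_div_iff_mul_eq', ← hmul, sub_add_cancel]
  have rhs : L.upoint z ≫ (φ - 𝟙 E - 𝟙 E).hom.hom.hom = L.upoint (w * z - z - z) := by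
    change L.upoint z ≫ (φ' / 𝟙 L.curve.scheme / 𝟙 L.curve.scheme) = _
    rw [GrpObj.comp_div, GrpObj.comp_div, hφ', Category.comp_id, hupt, hupt, ← hdiv, ← hdiv,
      ← PeriodPair.toPointHom_apply L.toPoint_add_holds, ← PeriodPair.toPointHom_apply L.toPoint_add_holds,
      ← map_sub, ← map_sub]
    rfl
  change L.upoint z ≫ (φ ≫ φ).hom.hom.hom = L.upoint z ≫ (φ - 𝟙 E - 𝟙 E).hom.hom.hom
  rw [lhs, rhs]
  congr 1
  have hw2' : w * w = w - 2 := by rw [← sq, hw2]; push_cast; ring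
  rw [← mul_assoc, hw2']
  ring


end

/-- **Stub T_A1 (r5) — the CM curve `j = -3375` with `[w]`, `w = (1+√-7)/2`, as an `AbelianVariety ℂ`
endomorphism, acting as `z ↦ wz` on `E(ℂ) = ℂ/Λ`.** There are a period pair `L` (invariants
`(g₂, g₃) = (35, -49)`, `j = -15³`), `w ∈ ℂ` with `w² = w - 2`, the integer matrix `N` of `w` on the basis
`(ω₁, ω₂)` of `Λ`, and an ENDOMORPHISM `ι` of the abelian variety `E_Λ` with `ι ≫ ι = ι - 2` whose action on
complex points is `π(z) ↦ π(wz)` (`π = PeriodPair.upoint`). Proof: `CMCert.check7` gives the transformation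
identities for `℘(wz) = (P/Q)(℘ z)` (`CMCert.check_sound`); `exists_endomorphism_of_transformation` (Milne's
extension theorem and rigidity) gives `ι`; `wΛ ⊆ Λ` gives `N`; `ι ≫ ι = ι - 2` holds on `ℂ`-points
(`π(w²z) = π(wz − 2z)`), hence as morphisms (faithfulness, `SchemeOver.hom_ext_of_forall_algPoints`).
[cite: Cox2013, Prop. 14.9 (PDF pp. 318–319)] [cite: Milne1986AbelianVarieties, §3 Thm. 3.1] -/
theorem stub_cmCurveAction :
    ∃ (L : PeriodPair) (w : ℂ) (N : Matrix (Fin 2) (Fin 2) ℤ) (ι : (L.curve.abelianVarietyOfAddHom L.curve.addHom L.curve.negHom L.curve.lift_pointEquiv_comp_addHom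
          L.curve.pointEquiv_comp_negHom_geom) ⟶
        (L.curve.abelianVarietyOfAddHom L.curve.addHom L.curve.negHom L.curve.lift_pointEquiv_comp_addHom
          L.curve.pointEquiv_comp_negHom_geom)),
      w * w = w - 2 ∧
      (w * L.ω₁ = (N 0 0 : ℂ) * L.ω₁ + (N 0 1 : ℂ) * L.ω₂) ∧
      (w * L.ω₂ = (N 1 0 : ℂ) * L.ω₁ + (N 1 1 : ℂ) * L.ω₂) ∧
      ι ≫ ι = ι - (2 : ℤ) • 𝟙 (L.curve.abelianVarietyOfAddHom L.curve.addHom L.curve.negHom L.curve.lift_pointEquiv_comp_addHom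
          L.curve.pointEquiv_comp_negHom_geom) ∧
      ∀ z : ℂ, L.upoint z ≫ ι.hom.hom.hom = L.upoint (w * z) :=
  stub_cmCurveAction_aux

end Summit.HodgeConjecture.HodgeConjecture.Theorems.WeilTwelvefoldsSqrtMinus7.AmnesicSecantSheaves

end
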